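import Summits.RiemannHypothesis.RiemannHypothesis.Theorems.TiltedLandingLaw421R3Lens1ArcSignI
import Summits.RiemannHypothesis.RiemannHypothesis.Theorems.TiltedLandingLaw421R3NestedSign

-- ======== AtomicSplit-v2 852279c2c33faab4 (part J; import lines stripped) ========

/-!
# TiltedLandingLaw421R3 — lens-1 (part J): the ATOMIC SPLIT of the crossing-mate residual

LENS-1 gen-7 module image `rh33346-cover/lens-1/AtomicSplit-v1.lean` (landing target `…/Theorems/TiltedLandingLaw421R3Lens1ArcSignJ.lean`; single
SHAPE v2 («≤ 1 net-ascending bad piece») is DEAD on the full residual (W7, cluster `P = 3`, two ascending pieces) but ALIVE on the ATOMIC class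
(`P = 2`: C6 g38 seal census 0 / 522 885); so the residual `TopPinningNonNestedAscResidual` (part I) is split by cluster size.

CONTENT. §1 MATES and the ATOMIC class: `IsMate` (= the negation of `JensenIsolated`ʼs clause at one zero), `OffChain`, `Atomic f j a v` («`v` is the
ONE interior crossing mate of `a` and the cluster is exactly `{a, v}`»), `AscLeOne` / `NetLeOne` (the shape in part Fʼs sign-word currency: on every small
circle outside finitely many radii, `#asc ≤ 1`, resp. `#asc ≤ #desc + 1`), ★ `AtomicShapeLawQ`, `AtomicNetLawQ`, ★ `NonAtomicTopResidualQ`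
(statements) · §2 `two_mul_card_le_nonrealZeroMult`, `four_le_nonrealZeroMult` (an interior second upper zero gives `N ≥ 4`, PROVED) · §3 ★ RUNG 4
`pinning_of_netLeOne` (PROVED: interior second upper zero + `NetLeOne` ⇒ the disjunction, by part Hʼs CONVERSION) · §4 ★ the PROVED glued split
`topPinningResidual_of_split : AtomicShapeLawQ → NonAtomicTopResidualQ → TopPinningNonNestedAscResidual` (and `topPinning_of_split`) · §5 ☆ PIN-P3
candidate `CentralChildDiscQ` (statement only; binder of nothing).

«ATOMIC» PRECISELY (= C6ʼs census class, seal g38): `v ≠ a` is an upper zero of the same `f^{(j)}` with `‖v − Re a‖ ≤ Im a` (INTERIOR: inside or on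
`a`ʼs Jensen circle), `Im a ≤ |Re a − Re v| + Im v` (not strictly nested: `v`ʼs closed Jensen disc reaches `a`ʼs circle — a CROSSING mate), and every
third upper zero is strictly disc-apart from both `a` and `v` (OFF-CHAIN; so the cluster of `a` is `{a, v}` and nothing is nested in either).
«NET-ASCENDING PIECE» PRECISELY: an element of part Fʼs `ascStarts f j a δ` (a bad piece of the circle `|w − Re a| = Im a + δ` entered with `Re φ < 0` and
left with `Re φ > 0`); «in J»: on the atomic class every bad point of a small circle lies in the lens `J = C ∩ D_v` (gen-7 memo, lemma BadInLens — not
part of the typed law, which only counts).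

HONEST LABEL / PRICE: the split is EXACT bookkeeping plus ONE proved rung (RUNG 4); it prices the atomic class DOWN TO a pure sign-word statement
(`AscLeOne`), it does not prove it.  `AtomicShapeLawQ`, `NonAtomicTopResidualQ`, `TopPinning`, 33346, 33347 OPEN; nothing here bears on the truth of
RH; RH is not proved; checked ≠ landed ≠ proved.
-/

noncomputable section

namespace RhW08.Lens1ArcSign

open Complex Set Metric Filter Topology
open scoped Real
open Literature.Topology.PlaneTopology Literature.Analysis.Complex
open Summit.RiemannHypothesis.RiemannHypothesis.Theorems.Splittings.JensenWindow
open RhIdea6.G17.W07C7 RhIdea6.G17.W07C7.Rev6 RhIdea6.G18.W07C8.Law421BirthS RhIdea6.G19.W07C11.Seam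
open RhIdea6.G20.W07C12.Frac RhIdea6.G20.W07C12.StColP RhW07.C12.FieldSplit RhIdea6.G21.W07C13.TentMax
open RhW07.C14.TwoSided RhW07.C14.Classes RhW07.C14.Lineage RhW07.C14.Booking
open RhW07.C13.Heredity RhIdea6.G22.W07C15pre.Injection RhW07.E3.Cell RhW07.E3.Lit
open RhW08.Round1 RhW08.StSwap RhW08.Round2 RhW08.QuadW RhW08.SealSwapQ RhW08.SealSwap RhW08.SuccB RhW08.SuccSplit
open RhW08.SuccTheft RhW08.Column RhW08.Hurwitz RhW08.ClusterQ RhW08.ClusterQM RhW08.NewtonDoor RhW08.NewtonDoorGenusOne RhW08.PurseP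
open RhW08.Lens1SignCut RhW08.Lens1Coverage RhW08.IsolatedTilt RhW08.Lens1Pinning RhW08.Lens1PinningIso

/-! ## §1 Mates, the atomic class, the shape laws -/

/-- `c` is a MATE of the upper zero `a` of `f^{(j)}`: another upper zero whose closed Jensen disc is neither strictly apart from `a`ʼs nor strictly
nested in it — the negation of `JensenIsolated`ʼs clause at `c`. -/
def IsMate (f : ℂ → ℂ) (j : ℕ) (a c : ℂ) : Prop :=
  iteratedDeriv j f c = 0 ∧ 0 < c.im ∧ c ≠ a ∧ ¬ (a.im + c.im < |a.re - c.re| ∨ |a.re - c.re| + c.im < a.im)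

/-- `¬ JensenIsolated` = some mate exists. -/
theorem exists_isMate_of_not_jensenIsolated {f : ℂ → ℂ} {j : ℕ} {a : ℂ} (hJ : ¬ JensenIsolated f j a) : ∃ c, IsMate f j a c := by
  by_contra h
  push Not at h
  exact hJ fun c hc hcpos hca => by
    by_contra hnot
    exact h c ⟨hc, hcpos, hca, hnot⟩

/-- A mate witnesses non-isolation: `IsMate f j a c → ¬ JensenIsolated f j a`. -/
theorem not_jensenIsolated_of_isMate {f : ℂ → ℂ} {j : ℕ} {a c : ℂ} (h : IsMate f j a c) : ¬ JensenIsolated f j a :=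
  fun hJ => h.2.2.2 (hJ c h.1 h.2.1 h.2.2.1)

/-- OFF-CHAIN: every upper zero of `f^{(j)}` other than `a`, `v` is strictly disc-apart from both. -/
def OffChain (f : ℂ → ℂ) (j : ℕ) (a v : ℂ) : Prop :=
  ∀ c : ℂ, iteratedDeriv j f c = 0 → 0 < c.im → c ≠ a → c ≠ v → a.im + c.im < |a.re - c.re| ∧ v.im + c.im < |v.re - c.re|

/-- ★ ATOMIC: `v` is the ONE INTERIOR CROSSING MATE of `a` and the cluster is exactly `{a, v}` (module docstring). -/
def Atomic (f : ℂ → ℂ) (j : ℕ) (a v : ℂ) : Prop :=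
  iteratedDeriv j f v = 0 ∧ 0 < v.im ∧ v ≠ a ∧ ‖v - (a.re : ℂ)‖ ≤ a.im ∧ a.im ≤ |a.re - v.re| + v.im ∧ OffChain f j a v

/-- The atomic mate is a mate … -/
theorem isMate_of_atomic {f : ℂ → ℂ} {j : ℕ} {a v : ℂ} (hA : Atomic f j a v) : IsMate f j a v := by
  obtain ⟨hv, hvpos, hva, hvin, hnn, -⟩ := hA
  refine ⟨hv, hvpos, hva, ?_⟩
  have h1 : |a.re - v.re| ≤ ‖v - (a.re : ℂ)‖ := by
    have := abs_re_le_norm (v - (a.re : ℂ))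
    rw [sub_re, ofReal_re, abs_sub_comm] at this
    exact this
  rintro (h | h) <;> linarith

/-- … and the only one. -/
theorem eq_of_isMate_of_atomic {f : ℂ → ℂ} {j : ℕ} {a v c : ℂ} (hA : Atomic f j a v) (hc : IsMate f j a c) : c = v := by
  by_contra hcv
  exact hc.2.2.2 (Or.inl (hA.2.2.2.2.2 c hc.1 hc.2.1 hc.2.2.1 hcv).1)

/-- SHAPE v3 in part Fʼs currency: on every small Jensen circle of `a` outside finitely many radii there is AT MOST ONE net-ascending bad piece. -/
def AscLeOne (f : ℂ → ℂ) (j : ℕ) (a : ℂ) : Prop :=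
  ∃ d0 > 0, ∃ E : Set ℝ, E.Finite ∧ ∀ δ ∈ Ioo 0 d0 \ E, (ascStarts f j a δ).Finite ∧ (ascStarts f j a δ).ncard ≤ 1

/-- Its NET weakening (all the split consumes): `#asc ≤ #desc + 1` on the same circles. -/
def NetLeOne (f : ℂ → ℂ) (j : ℕ) (a : ℂ) : Prop :=
  ∃ d0 > 0, ∃ E : Set ℝ, E.Finite ∧ ∀ δ ∈ Ioo 0 d0 \ E, (ascStarts f j a δ).Finite ∧ (ascStarts f j a δ).ncard ≤ (descStarts f j a δ).ncard + 1

/-- `AscLeOne ⇒ NetLeOne` (at most one ascending piece certainly gives `#asc ≤ #desc + 1`). -/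
theorem netLeOne_of_ascLeOne {f : ℂ → ℂ} {j : ℕ} {a : ℂ} (h : AscLeOne f j a) : NetLeOne f j a := by
  obtain ⟨d0, hd0, E, hE, hA⟩ := h
  exact ⟨d0, hd0, E, hE, fun δ hδ => ⟨(hA δ hδ).1, (hA δ hδ).2.trans (by omega)⟩⟩

/-- ★ THE ATOMIC SHAPE LAW (OPEN; census 0 / 522 885, C6 seal g38): on a legal frame, a top (`NoTallerToucher`) upper zero `a` of `f^{(j)}` with an
ATOMIC mate `v`, both simple, has at most one net-ascending bad piece on every small Jensen circle outside finitely many radii. -/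
def AtomicShapeLawQ : Prop :=
  ∀ (η : ℝ) (f : ℂ → ℂ) (x₀ s hmax R Hs : ℝ) (B : ℕ), EngineHyps5 2 η f x₀ s hmax R Hs B → ∀ (j : ℕ) (a v : ℂ),
    iteratedDeriv j f a = 0 → 0 < a.im → NoTallerToucher f j a → Atomic f j a v →
    iteratedDeriv (j + 1) f a ≠ 0 → iteratedDeriv (j + 1) f v ≠ 0 → AscLeOne f j a

/-- Its net form (OPEN, weaker). -/
def AtomicNetLawQ : Prop :=
  ∀ (η : ℝ) (f : ℂ → ℂ) (x₀ s hmax R Hs : ℝ) (B : ℕ), EngineHyps5 2 η f x₀ s hmax R Hs B → ∀ (j : ℕ) (a v : ℂ),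
    iteratedDeriv j f a = 0 → 0 < a.im → NoTallerToucher f j a → Atomic f j a v →
    iteratedDeriv (j + 1) f a ≠ 0 → iteratedDeriv (j + 1) f v ≠ 0 → NetLeOne f j a

/-- The SHAPE law implies the NET law: `AtomicShapeLawQ → AtomicNetLawQ`. -/
theorem atomicNetLaw_of_atomicShapeLaw (h : AtomicShapeLawQ) : AtomicNetLawQ :=
  fun η f x₀ s hmax R Hs B hE j a v ha hapos hN hA hda hdv => netLeOne_of_ascLeOne (h η f x₀ s hmax R Hs B hE j a v ha hapos hN hA hda hdv)

/-- ★ THE NON-ATOMIC RESIDUAL (OPEN): part Iʼs residual `TopPinningNonNestedAscResidual` restricted to tops with NO atomic mate — i.e. cluster size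
`P ≥ 3` (two distinct mates, or a third zero chained to the mate), or the unique mate is EXTERIOR (`‖v − Re a‖ > Im a`). -/
def NonAtomicTopResidualQ : Prop :=
  ∀ (η : ℝ) (f : ℂ → ℂ) (x₀ s hmax R Hs : ℝ) (B : ℕ), EngineHyps5 2 η f x₀ s hmax R Hs B → ∀ (j : ℕ) (a : ℂ),
    iteratedDeriv j f a = 0 → 0 < a.im → NoTallerToucher f j a → ¬ JensenIsolated f j a → ¬ ArcSignClear f j a → ¬ ArcNoAsc f j a →
    ¬ ArcNetNonAsc f j a → (∀ u : ℂ, iteratedDeriv j f u = 0 → 0 < u.im → NestedIn a u → ¬ ArcNetNonAsc f j u) →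
    (∀ v : ℂ, ¬ Atomic f j a v) →
    (∃ w : ℂ, iteratedDeriv (j + 1) f w = 0 ∧ w.im ≠ 0 ∧ NestedStep a w) ∨ (∃ x : ℝ, |x - a.re| ≤ a.im ∧ NLEventOf f j x)

/-! ## §2 An interior second upper zero gives `N ≥ 4` -/

/-- Upper zeros of a real entire `G ≢ 0` in a disc centred on `ℝ` count twice in `nonrealZeroMult` (they and their conjugates). -/
theorem two_mul_card_le_nonrealZeroMult {G : ℂ → ℂ} (hG : Differentiable ℂ G) (hne : G ≠ 0) (hreal : ∀ x : ℝ, (G x).im = 0)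
    {c r : ℝ} (hr : 0 < r) (S : Finset ℂ) (hS : ∀ ρ ∈ S, G ρ = 0 ∧ 0 < ρ.im ∧ ρ ∈ ball (c : ℂ) r) :
    2 * (S.card : ℤ) ≤ nonrealZeroMult G c r := by
  classical
  set L : ℝ := r + 1 with hL
  have hz₀ : ((c : ℂ)) ∈ Ioo (c - L) (c + L) ×ℂ Ioo (-(r + 1)) (r + 1) :=
    ofReal_mem_box (by rw [sub_self, abs_zero]; linarith) hr.le
  have hfin : {ρ : ℂ | G ρ = 0 ∧ ρ ∈ ball (c : ℂ) r ∧ ρ.im ≠ 0}.Finite := by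
    refine (finite_zeros_box hG hne hz₀).subset ?_
    rintro ρ ⟨h0, hρ, -⟩
    refine ⟨h0, ?_⟩
    rw [mem_ball, dist_eq_norm] at hρ
    have h1 := abs_re_le_norm (ρ - (c : ℂ))
    have h2 := abs_im_le_norm (ρ - (c : ℂ))
    rw [sub_re, ofReal_re, abs_le] at h1
    rw [sub_im, ofReal_im, sub_zero, abs_le] at h2
    exact mem_reProdIm.2 ⟨⟨by linarith [h1.1], by linarith [h1.2]⟩, ⟨by linarith [h2.1], by linarith [h2.2]⟩⟩
  have hconj : ∀ ρ ∈ ball ((c : ℝ) : ℂ) r, (starRingEnd ℂ) ρ ∈ ball ((c : ℝ) : ℂ) r := by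
    intro ρ hρ
    rw [mem_ball, dist_eq_norm] at hρ ⊢
    have e : (starRingEnd ℂ) ρ - (c : ℂ) = (starRingEnd ℂ) (ρ - (c : ℂ)) := by rw [map_sub, Complex.conj_ofReal]
    rw [e, Complex.norm_conj]
    exact hρ
  have hSsub : S ⊆ hfin.toFinset := by
    intro ρ hρ
    rw [Set.Finite.mem_toFinset]
    obtain ⟨h0, hpos, hb⟩ := hS ρ hρ
    exact ⟨h0, hb, hpos.ne'⟩
  have hS'sub : S.image (starRingEnd ℂ) ⊆ hfin.toFinset := by
    intro ρ hρ
    rw [Finset.mem_image] at hρ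
    obtain ⟨σ, hσ, rfl⟩ := hρ
    obtain ⟨h0, hpos, hb⟩ := hS σ hσ
    rw [Set.Finite.mem_toFinset]
    refine ⟨by rw [apply_conj_eq_conj hG hreal, h0, map_zero], hconj σ hb, ?_⟩
    simpa using hpos.ne'
  have hdisj : Disjoint S (S.image (starRingEnd ℂ)) := by
    rw [Finset.disjoint_left]
    intro ρ hρ hρ'
    rw [Finset.mem_image] at hρ'
    obtain ⟨σ, hσ, hσρ⟩ := hρ'
    have h1 := (hS ρ hρ).2.1
    have h2 := (hS σ hσ).2.1
    have h3 : ρ.im = -σ.im := by rw [← hσρ]; simp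
    linarith
  have hU : S ∪ S.image (starRingEnd ℂ) ⊆ hfin.toFinset := Finset.union_subset hSsub hS'sub
  have hcard : ((S ∪ S.image (starRingEnd ℂ)).card : ℤ) = 2 * S.card := by
    rw [Finset.card_union_of_disjoint hdisj, Finset.card_image_of_injective _ (starRingEnd ℂ).injective]
    push_cast
    ring
  have hpos : ∀ ρ ∈ hfin.toFinset, 0 < (meromorphicOrderAt G ρ).untop₀ := by
    intro ρ hρ
    rw [Set.Finite.mem_toFinset] at hρ
    exact untop₀_order_pos hG hne hρ.1
  unfold nonrealZeroMult
  rw [finsum_mem_eq_finite_toFinset_sum _ hfin]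
  have h1 := Finset.sum_le_sum_of_subset_of_nonneg hU (fun ρ hρ _ => (hpos ρ hρ).le)
  have h2 : (S ∪ S.image (starRingEnd ℂ)).card • (1 : ℤ) ≤ ∑ ρ ∈ S ∪ S.image (starRingEnd ℂ), (meromorphicOrderAt G ρ).untop₀ :=
    Finset.card_nsmul_le_sum _ _ 1 fun ρ hρ => by have := hpos ρ (hU hρ); omega
  rw [nsmul_eq_mul, mul_one] at h2
  linarith

/-- `a` lies in each of its enlarged Jensen discs. -/
theorem self_mem_ball {a : ℂ} (hapos : 0 < a.im) {δ : ℝ} (hδ : 0 < δ) : a ∈ ball ((a.re : ℝ) : ℂ) (a.im + δ) := by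
  rw [mem_ball, dist_eq_norm]
  have e : a - (a.re : ℂ) = ((a.im : ℝ) : ℂ) * I := Complex.ext (by simp) (by simp)
  rw [e, norm_mul, Complex.norm_real, Complex.norm_I, mul_one, Real.norm_eq_abs, abs_of_pos hapos]
  linarith

/-- ★ `N ≥ 4` on every disc `|w − Re a| < Im a + δ` when a SECOND upper zero `v ≠ a` of the real entire `G ≢ 0` lies in `‖v − Re a‖ ≤ Im a`. -/
theorem four_le_nonrealZeroMult {G : ℂ → ℂ} (hG : Differentiable ℂ G) (hne : G ≠ 0) (hreal : ∀ x : ℝ, (G x).im = 0) {a v : ℂ}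
    (ha : G a = 0) (hapos : 0 < a.im) (hv : G v = 0) (hvpos : 0 < v.im) (hva : v ≠ a) (hvin : ‖v - (a.re : ℂ)‖ ≤ a.im) {δ : ℝ}
    (hδ : 0 < δ) : 4 ≤ nonrealZeroMult G a.re (a.im + δ) := by
  classical
  have hr : 0 < a.im + δ := by linarith
  have hvball : v ∈ ball ((a.re : ℝ) : ℂ) (a.im + δ) := by
    rw [mem_ball, dist_eq_norm]
    linarith
  have h := two_mul_card_le_nonrealZeroMult hG hne hreal hr {a, v} (by
    intro ρ hρ
    rcases Finset.mem_insert.1 hρ with rfl | hρ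
    · exact ⟨ha, hapos, self_mem_ball hapos hδ⟩
    · rw [Finset.mem_singleton.1 hρ]
      exact ⟨hv, hvpos, hvball⟩)
  rw [Finset.card_pair hva.symm] at h
  push_cast at h
  linarith

/-! ## §3 RUNG 4: an interior second zero and `NetLeOne` give the disjunction -/

/-- ★★★ RUNG 4 (PROVED).  On a legal frame, an upper zero `a` of `f^{(j)}` with a SECOND upper zero `v ≠ a` in `‖v − Re a‖ ≤ Im a` and with
`#asc ≤ #desc + 1` on every small Jensen circle outside finitely many radii has a non-real zero of `f^{(j+1)}` in its closed Jensen disc or an NL event of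
level `j` in its closed base: `N ≥ 4` (§2) turns `#asc − #desc ≤ 1` into the count law `2(#asc − #desc) ≤ N − 2`, and part Hʼs CONVERSION concludes. -/
theorem pinning_of_netLeOne {η : ℝ} {f : ℂ → ℂ} {x₀ s hmax R Hs : ℝ} {B : ℕ} (hE : EngineHyps5 2 η f x₀ s hmax R Hs B) {j : ℕ} {a v : ℂ}
    (ha : iteratedDeriv j f a = 0) (hapos : 0 < a.im) (hv : iteratedDeriv j f v = 0) (hvpos : 0 < v.im) (hva : v ≠ a)
    (hvin : ‖v - (a.re : ℂ)‖ ≤ a.im) (hN : NetLeOne f j a) :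
    (∃ w : ℂ, iteratedDeriv (j + 1) f w = 0 ∧ w.im ≠ 0 ∧ NestedStep a w) ∨ (∃ x : ℝ, |x - a.re| ≤ a.im ∧ NLEventOf f j x) := by
  classical
  by_cases hnz : iteratedDeriv j f = 0
  · left
    refine ⟨a, ?_, hapos.ne', ?_⟩
    · rw [iteratedDeriv_succ, hnz]; simp
    · show (a.re - a.re) ^ 2 + a.im ^ 2 ≤ a.im ^ 2
      simp
  have hf : RealEntireLt2 f := realEntireLt2_of_hyps hE
  have hGd : Differentiable ℂ (iteratedDeriv j f) := differentiable_iteratedDeriv_of_entire hf.diff j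
  have hGreal : ∀ x : ℝ, (iteratedDeriv j f x).im = 0 := im_iteratedDeriv_ofReal hf.diff hf.real j
  obtain ⟨d0, hd0, E, hEfin, hnet⟩ := hN
  refine pinning_of_arcCount_cofinite hE ha hapos ⟨d0, hd0, E, hEfin, fun δ hδ => ?_⟩
  obtain ⟨hfinA, hle⟩ := hnet δ hδ
  refine ⟨hfinA, ?_⟩
  have h4 := four_le_nonrealZeroMult hGd hnz hGreal ha hapos hv hvpos hva hvin hδ.1.1
  have hle' : ((ascStarts f j a δ).ncard : ℤ) ≤ (descStarts f j a δ).ncard + 1 := by exact_mod_cast hle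
  linarith

/-! ## §4 The glued split of the residual -/

/-- An interior point of `a`ʼs closed Jensen circle region is a `NestedStep` child position. -/
theorem nestedStep_of_norm_le {a v : ℂ} (hvin : ‖v - (a.re : ℂ)‖ ≤ a.im) : NestedStep a v := by
  unfold NestedStep
  have e : ‖v - (a.re : ℂ)‖ ^ 2 = (v.re - a.re) ^ 2 + v.im ^ 2 := by
    rw [Complex.sq_norm, Complex.normSq_apply]; simp; ring
  rw [← e]
  exact pow_le_pow_left₀ (norm_nonneg _) hvin 2

/-- ★ THE ATOMIC BRANCH: the net law pays the atomic class (multiple `a` or multiple `v` ⇒ that point is itself the child). -/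
theorem pinning_of_atomic (hL : AtomicNetLawQ) {η : ℝ} {f : ℂ → ℂ} {x₀ s hmax R Hs : ℝ} {B : ℕ} (hE : EngineHyps5 2 η f x₀ s hmax R Hs B)
    {j : ℕ} {a v : ℂ} (ha : iteratedDeriv j f a = 0) (hapos : 0 < a.im) (hN : NoTallerToucher f j a) (hA : Atomic f j a v) :
    (∃ w : ℂ, iteratedDeriv (j + 1) f w = 0 ∧ w.im ≠ 0 ∧ NestedStep a w) ∨ (∃ x : ℝ, |x - a.re| ≤ a.im ∧ NLEventOf f j x) := by
  by_cases hda : iteratedDeriv (j + 1) f a = 0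
  · exact Or.inl ⟨a, hda, hapos.ne', by show (a.re - a.re) ^ 2 + a.im ^ 2 ≤ a.im ^ 2; simp⟩
  by_cases hdv : iteratedDeriv (j + 1) f v = 0
  · exact Or.inl ⟨v, hdv, hA.2.1.ne', nestedStep_of_norm_le hA.2.2.2.1⟩
  exact pinning_of_netLeOne hE ha hapos hA.1 hA.2.1 hA.2.2.1 hA.2.2.2.1 (hL η f x₀ s hmax R Hs B hE j a v ha hapos hN hA hda hdv)

/-- ★★ THE GLUED SPLIT (net form): the atomic net law and the non-atomic residual give part Iʼs residual. -/
theorem topPinningResidual_of_netSplit (hL : AtomicNetLawQ) (hR : NonAtomicTopResidualQ) : TopPinningNonNestedAscResidual := by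
  intro η f x₀ s hmax R Hs B hE j a ha hapos hN hJ hS hA hM hnest
  by_cases hat : ∃ v : ℂ, Atomic f j a v
  · obtain ⟨v, hv⟩ := hat
    exact pinning_of_atomic hL hE ha hapos hN hv
  · push Not at hat
    exact hR η f x₀ s hmax R Hs B hE j a ha hapos hN hJ hS hA hM hnest hat

/-- ★★★ THE GLUED SPLIT: `AtomicShapeLawQ → NonAtomicTopResidualQ → TopPinningNonNestedAscResidual`. -/
theorem topPinningResidual_of_split (hL : AtomicShapeLawQ) (hR : NonAtomicTopResidualQ) : TopPinningNonNestedAscResidual :=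
  topPinningResidual_of_netSplit (atomicNetLaw_of_atomicShapeLaw hL) hR

/-- … hence `TopPinning` (part I). -/
theorem topPinning_of_split (hL : AtomicShapeLawQ) (hR : NonAtomicTopResidualQ) : TopPinning :=
  topPinning_of_nonNestedAscResidual (topPinningResidual_of_split hL hR)

/-- Converse bookkeeping: the non-atomic residual is a sub-case of the law (the atomic SHAPE law is NOT — it is strictly stronger on its class). -/
theorem nonAtomicResidual_of_topPinning (hP : TopPinning) : NonAtomicTopResidualQ :=
  fun η f x₀ s hmax R Hs B hE j a ha hapos hN _ _ _ _ _ _ => hP η f x₀ s hmax R Hs B hE j a ha hapos hN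

/-- In the residual the atomic mate, when it exists, is THE mate: `¬ JensenIsolated` produces a mate and `Atomic` makes it unique. -/
theorem atomic_mate_unique {f : ℂ → ℂ} {j : ℕ} {a v : ℂ} (hA : Atomic f j a v) : ∀ c, IsMate f j a c ↔ c = v :=
  fun _ => ⟨fun hc => eq_of_isMate_of_atomic hA hc, fun h => h ▸ isMate_of_atomic hA⟩

/-! ## §5 PIN-P3: the central-child candidate for clusters `P ≥ 3` (statement only) -/

/-- ☆ CANDIDATE LAW «PIN-P3» (STATEMENT ONLY — binder of nothing; SUMMON (O7-3)).  On a legal frame, a top upper zero `a` of `f^{(j)}` with TWO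
DISTINCT INTERIOR mates `v ≠ u` (`‖v − Re a‖ ≤ Im a`, `‖u − Re a‖ ≤ Im a`; cluster size `P ≥ 3`) whose small circles are NOT net-non-ascending
(the `K < 0` proxy of the residual) has a NON-REAL zero of `f^{(j+1)}` in its CLOSED Jensen disc — the FIRST disjunct of the law, no NL escape needed.
FIRST INSTANCE (C6 g38, frame W7): `a = i`, `v = 0.55 + 0.81 i`, `u = 0.81 + 0.54 i`, no teeth, background weight `g = −12`: `#asc = 2` in the lens
`J_v` for `g ∈ (−19.46, −8.48)` (so SHAPE v2 fails there), yet the central child `w ≈ 0.0637 + 0.9882 i` of the cluster lies in `D̄_a`.  C6ʼs closed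
form for the atomic central child (`z_c = m + G − s √(G² + d²)`, `m = (a+v)/2`, `d = (a−v)/2`, `G = −1/F(m)`) is recorded in the gen-7 memo, not typed.
Why it might fail: a far exterior field (teeth / a heavy pair outside the column) can drag the clusterʼs children out of `D̄_a` while keeping `K < 0`
(no census of that regime yet). -/
def CentralChildDiscQ : Prop :=
  ∀ (η : ℝ) (f : ℂ → ℂ) (x₀ s hmax R Hs : ℝ) (B : ℕ), EngineHyps5 2 η f x₀ s hmax R Hs B → ∀ (j : ℕ) (a v u : ℂ),
    iteratedDeriv j f a = 0 → 0 < a.im → NoTallerToucher f j a → IsMate f j a v → IsMate f j a u → v ≠ u →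
    ‖v - (a.re : ℂ)‖ ≤ a.im → ‖u - (a.re : ℂ)‖ ≤ a.im → ¬ ArcNetNonAsc f j a →
    ∃ w : ℂ, iteratedDeriv (j + 1) f w = 0 ∧ w.im ≠ 0 ∧ NestedStep a w

/-- PIN-P3 pays its class inside `NonAtomicTopResidualQ` (bookkeeping only; the class with an exterior mate or an on-chain third zero is not covered). -/
theorem nonAtomic_twoInteriorMates_of_centralChild (hC : CentralChildDiscQ) {η : ℝ} {f : ℂ → ℂ} {x₀ s hmax R Hs : ℝ} {B : ℕ}
    (hE : EngineHyps5 2 η f x₀ s hmax R Hs B) {j : ℕ} {a v u : ℂ} (ha : iteratedDeriv j f a = 0) (hapos : 0 < a.im)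
    (hN : NoTallerToucher f j a) (hv : IsMate f j a v) (hu : IsMate f j a u) (hvu : v ≠ u) (hvin : ‖v - (a.re : ℂ)‖ ≤ a.im)
    (huin : ‖u - (a.re : ℂ)‖ ≤ a.im) (hM : ¬ ArcNetNonAsc f j a) :
    (∃ w : ℂ, iteratedDeriv (j + 1) f w = 0 ∧ w.im ≠ 0 ∧ NestedStep a w) ∨ (∃ x : ℝ, |x - a.re| ≤ a.im ∧ NLEventOf f j x) :=
  Or.inl (hC η f x₀ s hmax R Hs B hE j a v u ha hapos hN hv hu hvu hvin huin hM)

end RhW08.Lens1ArcSign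

-- ======== AtomicLens-v1 dcb386b07eff4002 (part K; import lines stripped) ========

/-!
# TiltedLandingLaw421R3 — lens-1 (part K): bad points live in the LENS; the FOOT ARC; ORDER ⇒ the atomic SHAPE law

LENS-1 gen-7 module image `rh33346-cover/lens-1/AtomicLens-v1.lean` (landing target `…/Theorems/TiltedLandingLaw421R3Lens1ArcSignK.lean`; imports part J
= image `lens-1/AtomicSplit-v1.lean` d20ba21dd3d75e0e until it is tree, and the tree kernel `…R3NestedSign` (`RhW08.NestedSign.exists_cofactor`,
`im_mul_im_logDeriv_nonpos`, `im_mul_normSq_of_crit`); namespace `RhW08.Lens1ArcSign`; 0 `sorry`; checked BY CHAIN `lens-1/AtomicSplitLens-v1-chain.lean`).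
SUMMON (O7-2) of director-rh g25: the ATOMIC RUNG attempt.

CONTENT. §1 lens geometry: `circleLoop_ofReal_re`, `normSq_sub_of_onCircle`, ★ `lens_mono_right` / `lens_mono_left` (membership of `D_v` is MONOTONE toward
the `v`-side foot along the circle) and `lens_initial_segment` (in `t`: for `Re a ≤ Re v` the lens `J = C ∩ D_v` meets the upper semicircle in an INITIAL
`t`-segment at the right foot) · §2 ★★ `bad_subset_lens` (PROVED, «BadInLens»): on a legal frame, if `v ≠ a` is a SIMPLE upper zero of `f^{(j)}` and every
OTHER upper zero is strictly disc-apart from `a`, then for `0 < δ < g` (the uniform far gap) every upper point `w` of the circle `|w − Re a| = Im a + δ` with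
`Im φ(w) > 0` lies in the open lens: `‖w − Re v‖ < Im v` — by global pair removal `f^{(j)} = pairQ · h`, the Jensen sign lemma for `h` (`w` is Jensen-clear
for `h`), and `Im (2(w − Re v)/pairQ(w)) · |pairQ(w)|² = 2 Im w (Im v² − ‖w − Re v‖²)`; corollary `bad_subset_lens_of_atomic` · §3 ORDER: `ArcOrder f j a δ`
(:= for bad pieces `(t₁,t₂)`, `(t₃,t₄)` with `t₂ ≤ t₃`: `Re φ(t₂) ≤ Re φ(t₃)` — C6ʼs «hi_i ≤ lo_j», tilt included, mirror-invariant), ★ `AtomicOrderLawQ`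
(OPEN), and the PROVED reduction `ascStarts_subsingleton_of_order` ⇒ `atomicShapeLaw_of_orderLaw : AtomicOrderLawQ → AtomicShapeLawQ` (two ascending
pieces `P < P′` would need `Re φ(end P) > 0 > Re φ(start P′)`), hence `topPinningResidual_of_orderSplit : AtomicOrderLawQ → NonAtomicTopResidualQ →
TopPinningNonNestedAscResidual`.

VERDICTS on C6ʼs regularities (SUMMON (O7-2); EngineHyps5 + one-mate geometry vs new input):
* BadInLens — PROVED here (frame + simplicity of `v` + far-ness of the third zeros from `a`; neither `NoTallerToucher` nor interiority is used).
* FOOT ARC — PROVED here (pure geometry: on `‖w − Re a‖ = r`, `‖w − Re v‖² = r² + (Re v − Re a)² − 2(Re v − Re a)(Re w − Re a)` is affine decreasing in `Re w`).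
* ORDER — NEEDS NEW INPUT: the nodal-domain topology of `Im φ` inside `D_a` (C6 g37 §2.6 Proposition: the negative tongue between two pieces (i) meets `C_a`
  only along the gap and (ii) carries no real zero of `f^{(j)}` on its boundary; then `Re φ` increases along the sealing arc by Cauchy–Riemann).  Why it might
  fail: a tooth on the tongueʼs boundary flips `Re φ` from `+∞` to `−∞`, or the tongue reaches a second arc; census 0 / 5 845 two-piece + 0 / 247 360 adversarial
  tooth insertions (g37), 174/174 + 75/75 (g38), never refuted, unproved.
* (S*a) «≤ 2 pieces in J, the first at the foot» — NEEDS NEW INPUT: a zero-count for the one-variable function `K_{k,m}(c)` on `J` (convexity trick of C6ʼs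
  Theorem A covers backgrounds (k teeth, 0 pairs) on the exact circle; one exterior pair = cubic; ≥ 2 pairs open).  Why it might fail: a third piece for two
  exterior pairs + teeth (0 in 522 885, not adversarially climbed for three pieces); NOT needed once ORDER holds.
* (S*b) «foot piece and hump never ascend together» — ⟸ ORDER (disjoint tilt windows); nothing separate to prove.
LARGEST PROVABLE SUB-CLASS NOW: none beyond the trivial ones inside EngineHyps5 (Theorem Aʼs class «no exterior pair at all» is a statement about toy
products `e^{gz}·poly`, whose transversality-in-δ step is configuration-wise; typing it as a frame sub-class buys no registry row) — recorded, not typed.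

HONEST LABEL: two lemmas and one reduction; `AtomicOrderLawQ`, `AtomicShapeLawQ`, `NonAtomicTopResidualQ`, `TopPinning`, 33346, 33347 OPEN; nothing here bears
on the truth of RH; RH is not proved; checked ≠ landed ≠ proved.
-/

noncomputable section

namespace RhW08.Lens1ArcSign

open Complex Set Metric Filter Topology
open scoped Real ComplexConjugate
open Literature.Topology.PlaneTopology Literature.Analysis.Complex
open Summit.RiemannHypothesis.RiemannHypothesis.Theorems.Splittings.JensenWindow
open RhIdea6.G17.W07C7 RhIdea6.G17.W07C7.Rev6 RhIdea6.G18.W07C8.Law421BirthS RhIdea6.G19.W07C11.Seam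
open RhIdea6.G20.W07C12.Frac RhIdea6.G20.W07C12.StColP RhW07.C12.FieldSplit RhIdea6.G21.W07C13.TentMax
open RhW07.C14.TwoSided RhW07.C14.Classes RhW07.C14.Lineage RhW07.C14.Booking
open RhW07.C13.Heredity RhIdea6.G22.W07C15pre.Injection RhW07.E3.Cell RhW07.E3.Lit
open RhW08.Round1 RhW08.StSwap RhW08.Round2 RhW08.QuadW RhW08.SealSwapQ RhW08.SealSwap RhW08.SuccB RhW08.SuccSplit
open RhW08.SuccTheft RhW08.Column RhW08.Hurwitz RhW08.ClusterQ RhW08.ClusterQM RhW08.NewtonDoor RhW08.NewtonDoorGenusOne RhW08.PurseP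
open RhW08.Lens1SignCut RhW08.Lens1Coverage RhW08.IsolatedTilt RhW08.Lens1Pinning RhW08.Lens1PinningIso

/-! ## §1 Geometry of the lens `J = C ∩ D_v` -/

/-- `Re` along the circle loop of real centre `c`: `c + r cos 2πt`. -/
theorem circleLoop_ofReal_re (c r t : ℝ) : (circleLoop (c : ℂ) r t).re = c + r * Real.cos (2 * π * t) := by
  have e : (2 * ↑π * ↑t * I : ℂ) = ((2 * π * t : ℝ) : ℂ) * I := by push_cast; ring
  rw [circleLoop_apply, e, add_re, ofReal_re, re_ofReal_mul, exp_ofReal_mul_I_re]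

/-- On the circle `‖w − p‖ = r`: `‖w − x‖² = r² + (x − p)² − 2(x − p)(Re w − p)` — AFFINE and, for `x ≥ p`, DECREASING in `Re w`. -/
theorem normSq_sub_of_onCircle {w : ℂ} {p r : ℝ} (x : ℝ) (hw : ‖w - (p : ℂ)‖ = r) :
    ‖w - (x : ℂ)‖ ^ 2 = r ^ 2 + (x - p) ^ 2 - 2 * (x - p) * (w.re - p) := by
  have e1 : ‖w - (p : ℂ)‖ ^ 2 = (w.re - p) ^ 2 + w.im ^ 2 := by rw [Complex.sq_norm, Complex.normSq_apply]; simp; ring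
  have e2 : ‖w - (x : ℂ)‖ ^ 2 = (w.re - x) ^ 2 + w.im ^ 2 := by rw [Complex.sq_norm, Complex.normSq_apply]; simp; ring
  rw [hw] at e1
  rw [e2, e1]
  ring

/-- ★ FOOT ARC, `v` on the right (`p ≤ x`): membership of the open lens `‖· − x‖ < y` is monotone toward the RIGHT foot along the circle. -/
theorem lens_mono_right {w w' : ℂ} {p r x y : ℝ} (hw : ‖w - (p : ℂ)‖ = r) (hw' : ‖w' - (p : ℂ)‖ = r) (hpx : p ≤ x) (hre : w.re ≤ w'.re)
    (hin : ‖w - (x : ℂ)‖ < y) : ‖w' - (x : ℂ)‖ < y := by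
  have h1 := normSq_sub_of_onCircle x hw
  have h2 := normSq_sub_of_onCircle x hw'
  have hle : ‖w' - (x : ℂ)‖ ^ 2 ≤ ‖w - (x : ℂ)‖ ^ 2 := by rw [h1, h2]; nlinarith
  exact ((pow_le_pow_iff_left₀ (norm_nonneg _) (norm_nonneg _) two_ne_zero).1 hle).trans_lt hin

/-- FOOT ARC, `v` on the left (`x ≤ p`): monotone toward the LEFT foot. -/
theorem lens_mono_left {w w' : ℂ} {p r x y : ℝ} (hw : ‖w - (p : ℂ)‖ = r) (hw' : ‖w' - (p : ℂ)‖ = r) (hxp : x ≤ p) (hre : w'.re ≤ w.re)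
    (hin : ‖w - (x : ℂ)‖ < y) : ‖w' - (x : ℂ)‖ < y := by
  have h1 := normSq_sub_of_onCircle x hw
  have h2 := normSq_sub_of_onCircle x hw'
  have hle : ‖w' - (x : ℂ)‖ ^ 2 ≤ ‖w - (x : ℂ)‖ ^ 2 := by rw [h1, h2]; nlinarith
  exact ((pow_le_pow_iff_left₀ (norm_nonneg _) (norm_nonneg _) two_ne_zero).1 hle).trans_lt hin

/-- ★ In the parameter `t` (`v` on the right, `Re a ≤ Re v`): the lens meets the upper semicircle `t ∈ [0, ½]` in an INITIAL segment at the right foot. -/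
theorem lens_initial_segment {a v : ℂ} {δ t t' : ℝ} (hr : 0 ≤ a.im + δ) (hav : a.re ≤ v.re) (ht : 0 ≤ t) (htt' : t ≤ t') (ht' : t' ≤ 1 / 2)
    (hin : ‖circleLoop (a.re : ℂ) (a.im + δ) t' - (v.re : ℂ)‖ < v.im) : ‖circleLoop (a.re : ℂ) (a.im + δ) t - (v.re : ℂ)‖ < v.im := by
  have hγ : ∀ s : ℝ, ‖circleLoop (a.re : ℂ) (a.im + δ) s - (a.re : ℂ)‖ = a.im + δ := fun s => by
    rw [norm_circleLoop_sub_center, abs_of_nonneg hr]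
  refine lens_mono_right (hγ t') (hγ t) hav ?_ hin
  rw [circleLoop_ofReal_re, circleLoop_ofReal_re]
  have hcos : Real.cos (2 * π * t') ≤ Real.cos (2 * π * t) :=
    Real.cos_le_cos_of_nonneg_of_le_pi (by positivity) (by nlinarith [Real.pi_pos]) (by nlinarith [Real.pi_pos])
  nlinarith [mul_le_mul_of_nonneg_left hcos hr]

/-- The mirror statement (`Re v ≤ Re a`): a FINAL segment at the left foot. -/
theorem lens_final_segment {a v : ℂ} {δ t t' : ℝ} (hr : 0 ≤ a.im + δ) (hva : v.re ≤ a.re) (ht : 0 ≤ t) (htt' : t ≤ t') (ht' : t' ≤ 1 / 2)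
    (hin : ‖circleLoop (a.re : ℂ) (a.im + δ) t - (v.re : ℂ)‖ < v.im) : ‖circleLoop (a.re : ℂ) (a.im + δ) t' - (v.re : ℂ)‖ < v.im := by
  have hγ : ∀ s : ℝ, ‖circleLoop (a.re : ℂ) (a.im + δ) s - (a.re : ℂ)‖ = a.im + δ := fun s => by
    rw [norm_circleLoop_sub_center, abs_of_nonneg hr]
  refine lens_mono_left (hγ t) (hγ t') hva ?_ hin
  rw [circleLoop_ofReal_re, circleLoop_ofReal_re]
  have hcos : Real.cos (2 * π * t') ≤ Real.cos (2 * π * t) :=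
    Real.cos_le_cos_of_nonneg_of_le_pi (by positivity) (by nlinarith [Real.pi_pos]) (by nlinarith [Real.pi_pos])
  nlinarith [mul_le_mul_of_nonneg_left hcos hr]

/-! ## §2 BadInLens: every bad point of a small circle lies in the open lens -/

/-- The uniform far gap keeps every point of the circle of radius `Im a + δ`, `δ < g`, Jensen-clear of a far zero `c`. -/
theorem im_lt_norm_sub_of_gap {a c w : ℂ} {δ g : ℝ} (hw : ‖w - (a.re : ℂ)‖ = a.im + δ) (hδg : δ < g)
    (hgap : a.im + |c.im| + g ≤ |a.re - c.re|) : |c.im| < ‖w - (c.re : ℂ)‖ := by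
  have h1 : |w.re - c.re| ≤ ‖w - (c.re : ℂ)‖ := by
    have := abs_re_le_norm (w - (c.re : ℂ)); rwa [sub_re, ofReal_re] at this
  have h2 : |w.re - a.re| ≤ a.im + δ := by
    have := abs_re_le_norm (w - (a.re : ℂ)); rw [sub_re, ofReal_re, hw] at this; exact this
  have h3 : |a.re - c.re| ≤ |a.re - w.re| + |w.re - c.re| := abs_sub_le a.re w.re c.re
  rw [abs_sub_comm a.re w.re] at h3
  linarith

set_option maxHeartbeats 800000 in
/-- ★★ BadInLens (PROVED).  Legal frame; `v ≠ a` a SIMPLE upper zero of `f^{(j)}`; every other upper zero strictly disc-apart from `a`.  Then for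
`0 < δ < g` every upper point `w` of the circle `|w − Re a| = Im a + δ` with `Im φ(w) > 0` lies in the open lens `‖w − Re v‖ < Im v`. -/
theorem bad_subset_lens {η : ℝ} {f : ℂ → ℂ} {x₀ s hmax R Hs : ℝ} {B : ℕ} (hE : EngineHyps5 2 η f x₀ s hmax R Hs B) {j : ℕ} {a v : ℂ}
    (ha : iteratedDeriv j f a = 0) (hapos : 0 < a.im) (hv : iteratedDeriv j f v = 0) (hvpos : 0 < v.im)
    (hvs : iteratedDeriv (j + 1) f v ≠ 0)
    (hfar : ∀ c : ℂ, iteratedDeriv j f c = 0 → 0 < c.im → c ≠ a → c ≠ v → a.im + c.im < |a.re - c.re|) :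
    ∃ g > 0, ∀ δ ∈ Ioo 0 g, ∀ t : ℝ, 0 < (circleLoop (a.re : ℂ) (a.im + δ) t).im → 0 < (arcPhi f j a δ t).im →
      ‖circleLoop (a.re : ℂ) (a.im + δ) t - (v.re : ℂ)‖ < v.im := by
  classical
  have hf : RealEntireLt2 f := realEntireLt2_of_hyps hE
  set G : ℂ → ℂ := iteratedDeriv j f with hGdef
  have hG : RealEntireLt2 G := RhW08.WindowLoss.realEntireLt2_iteratedDeriv hf j
  have e1 : deriv G = iteratedDeriv (j + 1) f := by rw [hGdef, ← iteratedDeriv_succ]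
  have hnz : G ≠ 0 := by
    intro h0
    apply hvs
    rw [← e1, h0]; simp
  have hstrip : ∀ c : ℂ, G c = 0 → |c.im| ≤ Hs := fun c hc => abs_im_le_of_level hE hnz hc
  have haHs : a.im ≤ Hs := by have := hstrip a ha; rwa [abs_of_pos hapos] at this
  obtain ⟨g, hg0, -, hgap⟩ := exists_uniform_far_gap hG.diff hnz hstrip hapos haHs
  -- global pair removal `G = pairQ · h`, `h(v) ≠ 0` by simplicity
  obtain ⟨h, hhd, ⟨ρ, C, hρ0, hρ, hgr⟩, hreal, hfac⟩ := RhW08.NestedSign.exists_cofactor hG hv hvpos.ne'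
  have hderiv : ∀ z, deriv G z = 2 * (z - v.re) * h z + pairQ v.re v.im z * deriv h z := by
    intro z
    have e : G = pairQ v.re v.im * h := funext fun u => by rw [Pi.mul_apply]; exact hfac u
    have hq : HasDerivAt (pairQ v.re v.im) (2 * (z - v.re)) z := RhW07.Law421.SuccessorCertificate.hasDerivAt_quadP v.re v.im z
    have hp := hq.mul (hhd z).hasDerivAt
    rw [e, hp.deriv]
  have hqv : pairQ v.re v.im v = 0 := by
    have e : v - (v.re : ℂ) = (v.im : ℂ) * I := by apply Complex.ext <;> simp
    rw [pairQ, e, mul_pow, Complex.I_sq]; ring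
  have hhv : h v ≠ 0 := by
    intro h0
    apply hvs
    rw [← e1, hderiv v, h0, hqv]; simp
  have hhvbar : h (conj v) ≠ 0 := by rw [apply_conj_eq_conj hhd hreal, map_ne_zero]; exact hhv
  refine ⟨g, hg0, fun δ hδ t hwim hφ => ?_⟩
  set w : ℂ := circleLoop (a.re : ℂ) (a.im + δ) t with hwdef
  have hr : 0 < a.im + δ := by linarith [hδ.1]
  have hw : ‖w - (a.re : ℂ)‖ = a.im + δ := by rw [hwdef, norm_circleLoop_sub_center, abs_of_pos hr]
  have hφdef : arcPhi f j a δ t = deriv G w / G w := rfl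
  have hGw : G w ≠ 0 := by
    intro h0
    rw [hφdef, h0, div_zero] at hφ
    simp at hφ
  have hqw : pairQ v.re v.im w ≠ 0 := by
    intro h0; apply hGw; rw [hfac w, h0, zero_mul]
  have hhw : h w ≠ 0 := by
    intro h0; apply hGw; rw [hfac w, h0, mul_zero]
  -- `w` is Jensen-clear for `h`
  have hout : ∀ z, h z = 0 → |z.im| < ‖w - (z.re : ℂ)‖ := by
    intro z hz
    have hGz : G z = 0 := by rw [hfac z, hz, mul_zero]
    have hzv : z ≠ v := by rintro rfl; exact hhv hz
    have hzvbar : z ≠ conj v := by rintro rfl; exact hhvbar hz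
    rcases lt_trichotomy z.im 0 with hneg | hzero | hposz
    · have hGc : G (conj z) = 0 := by rw [apply_conj_eq_conj hG.diff hG.real, hGz, map_zero]
      have hcim : 0 < (conj z).im := by rw [Complex.conj_im]; linarith
      have hcre : (conj z).re = z.re := Complex.conj_re z
      have habs : |(conj z).im| = |z.im| := by rw [Complex.conj_im, abs_neg]
      by_cases hca : conj z = a
      · have e2 : z.re = a.re := by rw [← hcre, hca]
        have e3 : |z.im| = a.im := by rw [← habs, hca, abs_of_pos hapos]
        rw [e2, e3, hw]
        linarith [hδ.1]
      · have hcv : conj z ≠ v := fun e => hzvbar (by rw [← e, Complex.conj_conj])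
        have hlt := hfar (conj z) hGc hcim hca hcv
        have hgap' := hgap (conj z) hGc (by rwa [abs_of_pos hcim])
        have := im_lt_norm_sub_of_gap hw hδ.2 hgap'
        rwa [habs, hcre] at this
    · rw [hzero, abs_zero]
      have h1 : |w.im| ≤ ‖w - (z.re : ℂ)‖ := by
        have := abs_im_le_norm (w - (z.re : ℂ)); rwa [sub_im, ofReal_im, sub_zero] at this
      rw [abs_of_pos hwim] at h1
      linarith
    · by_cases hza : z = a
      · rw [hza, hw, abs_of_pos hapos]
        linarith [hδ.1]
      · have hlt := hfar z hGz hposz hza hzv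
        have hgap' := hgap z hGz (by rwa [abs_of_pos hposz])
        exact im_lt_norm_sub_of_gap hw hδ.2 hgap'
  -- Jensen sign lemma for the cofactor
  have hsign := RhW08.NestedSign.im_mul_im_logDeriv_nonpos hhd hρ0 hρ hgr hreal hhw hout
  have hKh : (deriv h w / h w).im ≤ 0 := by
    by_contra hp
    push Not at hp
    have := mul_pos hwim hp
    linarith
  -- `φ = 2(w − Re v)/pairQ(w) + h′/h(w)`, so the pair term has positive imaginary part
  have hφeq : arcPhi f j a δ t = 2 * (w - v.re) / pairQ v.re v.im w + deriv h w / h w := by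
    rw [hφdef, hderiv w, hfac w]
    field_simp
  have hpair : 0 < (2 * (w - v.re) / pairQ v.re v.im w).im := by
    have : (arcPhi f j a δ t).im = (2 * (w - v.re) / pairQ v.re v.im w).im + (deriv h w / h w).im := by rw [hφeq, add_im]
    linarith
  -- ⇒ `w ∈ D_v`
  set K : ℂ := -(2 * (w - v.re) / pairQ v.re v.im w) with hK
  have hcrit : pairQ v.re v.im w * K = -(2 * (w - v.re)) := by
    rw [hK, mul_neg, mul_div_cancel₀ _ hqw]
  have hid := RhW08.NestedSign.im_mul_normSq_of_crit hvpos.ne' hcrit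
  have hKim : K.im < 0 := by rw [hK, neg_im]; linarith
  have hprod : K.im * Complex.normSq (pairQ v.re v.im w) < 0 := mul_neg_of_neg_of_pos hKim (Complex.normSq_pos.2 hqw)
  rw [hid] at hprod
  have h2 : 0 < 2 * w.im * (v.im ^ 2 - ((w.re - v.re) ^ 2 + w.im ^ 2)) := by linarith
  have hsq : (w.re - v.re) ^ 2 + w.im ^ 2 < v.im ^ 2 := by
    have := (mul_pos_iff_of_pos_left (by linarith : (0 : ℝ) < 2 * w.im)).1 h2
    linarith
  have e : ‖w - (v.re : ℂ)‖ ^ 2 = (w.re - v.re) ^ 2 + w.im ^ 2 := by rw [Complex.sq_norm, Complex.normSq_apply]; simp; ring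
  exact (pow_lt_pow_iff_left₀ (norm_nonneg _) hvpos.le two_ne_zero).1 (by rw [e]; exact hsq)

/-- ★ BadInLens on the ATOMIC class (part Jʼs `Atomic`; only its zero / positivity / off-chain-from-`a` clauses are used). -/
theorem bad_subset_lens_of_atomic {η : ℝ} {f : ℂ → ℂ} {x₀ s hmax R Hs : ℝ} {B : ℕ} (hE : EngineHyps5 2 η f x₀ s hmax R Hs B) {j : ℕ}
    {a v : ℂ} (ha : iteratedDeriv j f a = 0) (hapos : 0 < a.im) (hA : Atomic f j a v) (hvs : iteratedDeriv (j + 1) f v ≠ 0) :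
    ∃ g > 0, ∀ δ ∈ Ioo 0 g, ∀ t : ℝ, 0 < (circleLoop (a.re : ℂ) (a.im + δ) t).im → 0 < (arcPhi f j a δ t).im →
      ‖circleLoop (a.re : ℂ) (a.im + δ) t - (v.re : ℂ)‖ < v.im :=
  bad_subset_lens hE ha hapos hA.1 hA.2.1 hvs fun c hc hcpos hca hcv => (hA.2.2.2.2.2 c hc hcpos hca hcv).1

/-! ## §3 ORDER and the reduction ORDER ⇒ SHAPE -/

/-- ORDER at radius excess `δ` (C6 g37 §2.6 «hi_i ≤ lo_j», tilt included): for bad pieces `(t₁,t₂)`, `(t₃,t₄)` of the upper semicircle with `t₂ ≤ t₃`,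
`Re φ(t₂) ≤ Re φ(t₃)` — the `Re φ`-values at the piece ends are ordered along the semicircle.  Mirror-invariant (`t ↦ ½ − t`, `Re φ ↦ −Re φ`). -/
def ArcOrder (f : ℂ → ℂ) (j : ℕ) (a : ℂ) (δ : ℝ) : Prop :=
  ∀ t₁ t₂ t₃ t₄ : ℝ, BadPiece f j a δ t₁ t₂ → BadPiece f j a δ t₃ t₄ → t₂ ≤ t₃ → (arcPhi f j a δ t₂).re ≤ (arcPhi f j a δ t₃).re

/-- ★ THE ATOMIC ORDER LAW (OPEN; NEEDS NEW INPUT — nodal topology (i)/(ii); census 0 / 5 845, 174/174): on a legal frame, a top upper zero `a` with an atomic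
mate `v`, both simple, has ORDERED piece ends on every small Jensen circle outside finitely many radii. -/
def AtomicOrderLawQ : Prop :=
  ∀ (η : ℝ) (f : ℂ → ℂ) (x₀ s hmax R Hs : ℝ) (B : ℕ), EngineHyps5 2 η f x₀ s hmax R Hs B → ∀ (j : ℕ) (a v : ℂ),
    iteratedDeriv j f a = 0 → 0 < a.im → NoTallerToucher f j a → Atomic f j a v →
    iteratedDeriv (j + 1) f a ≠ 0 → iteratedDeriv (j + 1) f v ≠ 0 → ∃ d0 > 0, ∃ E : Set ℝ, E.Finite ∧ ∀ δ ∈ Ioo 0 d0 \ E, ArcOrder f j a δ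

/-- ★ ORDER ⇒ at most ONE ascending bad piece (two ascending pieces `P < P′` would give `Re φ(end P) > 0 > Re φ(start P′)`, against ORDER). -/
theorem ascStarts_subsingleton_of_order {f : ℂ → ℂ} {j : ℕ} {a : ℂ} {δ : ℝ} (hO : ArcOrder f j a δ) : (ascStarts f j a δ).Subsingleton := by
  intro t₁ ht₁ t₁' ht₁'
  obtain ⟨t₂, hP, hre1, hre2⟩ := ht₁
  obtain ⟨t₂', hP', hre1', hre2'⟩ := ht₁'
  by_contra hne
  rcases lt_or_gt_of_ne hne with hlt | hlt
  · have h23 : t₂ ≤ t₁' := by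
      by_contra hgt
      push Not at hgt
      have := hP.2.2.2.1 t₁' ⟨hlt, hgt⟩
      linarith [hP'.2.2.2.2.1]
    have := hO t₁ t₂ t₁' t₂' hP hP' h23
    linarith
  · have h23 : t₂' ≤ t₁ := by
      by_contra hgt
      push Not at hgt
      have := hP'.2.2.2.1 t₁ ⟨hlt, hgt⟩
      linarith [hP.2.2.2.2.1]
    have := hO t₁' t₂' t₁ t₂ hP' hP h23
    linarith

/-- A subsingleton set of reals is finite with `ncard ≤ 1`. -/
theorem finite_and_ncard_le_one {S : Set ℝ} (hS : S.Subsingleton) : S.Finite ∧ S.ncard ≤ 1 := by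
  refine ⟨hS.finite, ?_⟩
  rcases hS.eq_empty_or_singleton with h | ⟨x, h⟩
  · rw [h, Set.ncard_empty]; exact zero_le_one
  · rw [h, Set.ncard_singleton]

/-- ORDER on the small circles ⇒ `AscLeOne`. -/
theorem ascLeOne_of_order {f : ℂ → ℂ} {j : ℕ} {a : ℂ} (h : ∃ d0 > 0, ∃ E : Set ℝ, E.Finite ∧ ∀ δ ∈ Ioo 0 d0 \ E, ArcOrder f j a δ) :
    AscLeOne f j a := by
  obtain ⟨d0, hd0, E, hE, hO⟩ := h
  exact ⟨d0, hd0, E, hE, fun δ hδ => finite_and_ncard_le_one (ascStarts_subsingleton_of_order (hO δ hδ))⟩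

/-- ★★ THE REDUCTION: the atomic ORDER law gives the atomic SHAPE law. -/
theorem atomicShapeLaw_of_orderLaw (hO : AtomicOrderLawQ) : AtomicShapeLawQ :=
  fun η f x₀ s hmax R Hs B hE j a v ha hapos hN hA hda hdv => ascLeOne_of_order (hO η f x₀ s hmax R Hs B hE j a v ha hapos hN hA hda hdv)

/-- … hence ORDER + the non-atomic residual give part Iʼs residual (via part Jʼs split) … -/
theorem topPinningResidual_of_orderSplit (hO : AtomicOrderLawQ) (hR : NonAtomicTopResidualQ) : TopPinningNonNestedAscResidual :=
  topPinningResidual_of_split (atomicShapeLaw_of_orderLaw hO) hR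

/-- … and `TopPinning`. -/
theorem topPinning_of_orderSplit (hO : AtomicOrderLawQ) (hR : NonAtomicTopResidualQ) : TopPinning :=
  topPinning_of_split (atomicShapeLaw_of_orderLaw hO) hR

end RhW08.Lens1ArcSign
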